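import Literature.NumberTheory.Automorphic.JacquetRayFitting
import Mathlib.LinearAlgebra.Trace
import Mathlib.LinearAlgebra.Projection
import HarnessLib

/-!
# The Hecke ray operator on `V^K`, III: CASSELMAN'S TRACE IDENTITY `tr(T_a^m | V^K) = tr(π_N(a)^m | [V^K])` (`m ≥ 1`) —
# «characters and Jacquet modules» on the contracting shells, Hecke-ray form (Casselman 1977 Thm. 5.2; Casselman 1995 §4.1; rank-one kit R2c)

Topic `NumberTheory/Automorphic`; namespace `Representation` (sequel of ★ R1 `JacquetRayHeckeOperator`, ★ R2 `JacquetRayFitting`).  THEOREMS ONLY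
(no definition, no named fact, no instance, no notation, no `sorry`).  Cell `hodgecm-mathlib`, F0∕P3c line LH6 (closer row `stub_StCharTS` ∕ (N-1273S)
= [Rogawski1990, L.12.7.3]), seat LH6-p02 (g0), `--supports stmt-HodgeConjecture-24833 --as helper`: the FIRST ANALYTIC BRICK of the in-house road to
Lemma 12.7.3 — the engine behind «Recall that by Casselman's theorem, `χ_π(γ) = χ_{π_N}(γ)`» ([Rogawski1990] p. 193) and hence behind the use of
Prop. 12.5.1 in the proof of L.12.7.3 (p. 195: «This is only possible if `π₁ = π²(ξ)` … The character of `π₂` must then be compactly supported on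
`M` and `π₂` is thus supercuspidal»).  HONEST SCOPE: generic representation theory over any field of characteristic `0`; nothing here is
instantiated at `U(3)`, no letter closes; HC_CM is proved only modulo the printed citations until rung 0 closes.

SETTING as in R1∕R2: `ρ` an ADMISSIBLE representation of a topological group `G` on a `k`-vector space (`char k = 0`); `t = (P, M, N)` a
parabolic triple with `N` closed; `K ≤ G` compact open with an Iwahori factorisation `K = (K ∩ N̄)(K ∩ M)(K ∩ N)`; `a ∈ M` dominant
(`a (K ∩ N) a⁻¹ ⊆ K`, `a⁻¹ (K ∩ N̄) a ⊆ K ∩ N̄`, `[a, K ∩ M] = 1`) with `⋃ₘ a⁻ᵐ (K ∩ N) aᵐ = N`; `T_a = e_K ∘ π(a)` on `V^K`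
(★ `Representation.heckeRayEnd`), `[·] : V^K → V_N` the class map (★ `Representation.fixedPointsMk`), `[V^K]` its range (`= V_N^{K ∩ M}` at the
levels of an Iwahori datum, ★ `range_fixedPointsMk_eq`).

THE MATHEMATICS ([Casselman1977, Thm. 5.2]: for `f` supported on the `P`-contracting elements, `tr π(f) = tr π_N(f̄^P)`; bi-`K`-invariant shell
form [Casselman1995, Prop. 4.1.6 and its proof; BernsteinZelevinsky1976, 3.17–3.19]).  By ★ R2 there is a Fitting index `N₀`:
`V^K = ker T_a^{N₀} ⊕ im T_a^{N₀}` with both summands `T_a`-stable; `T_a` is NILPOTENT on the first, so `tr(T_a^m | ker) = 0` for `m ≥ 1`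
(a nilpotent endomorphism of a finite-dimensional space has trace `0`); on the second, `[·]` is INJECTIVE (★ `fixedPointsMk_injOn_range_pow`) with
image `[V^K]` (★ `map_fixedPointsMk_range_pow_eq`) and INTERTWINES `T_a` with `π_N(a)` (★ `mk_heckeRay`: `[T_a v] = π_N(a)[v]`), so
`T_a | im T_a^{N₀}` and `π_N(a) | [V^K]` are conjugate and have equal traces of all powers.  Hence
**`tr(T_a^m | V^K) = tr(π_N(a)^m | [V^K])` for every `m ≥ 1`** (§3 `trace_heckeRayEnd_pow_eq`) — false for `m = 0` in general
(`dim V^K ≠ dim [V^K]` as soon as `T_a` has a kernel).  With ★ `real_smul_trace_fixedPointsAlgHom_doubleCosetOperator`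
(`μ(K)·tr([KgK] | V^K) = tr π(𝟙_{KgK})`) this is the character of `π` on the shells `K aᵐ K` read off the Jacquet module.

* §1 `trace_pow_eq_trace_restrict_pow_of_isNilpotent` — linear algebra: `M = p ⊕ q` finite-dimensional, `f` preserving both, `f|p`
  nilpotent ⇒ `tr(f^m) = tr((f|q)^m)` for `m ≥ 1` (Mathlib ★ `Submodule.prodEquivOfIsCompl`, ★ `LinearMap.trace_prodMap'`, ★ `LinearMap.trace_conj'`,
  ★ `LinearMap.isNilpotent_trace_of_isNilpotent`).
* §2 `trace_restrict_eq_of_semiconj` — linear algebra: an intertwiner `φ` injective on `p` with `φ(p) = W` conjugates `f|p` to `g|W`, so their traces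
  (and those of their powers) agree.
* §3 `mapsTo_jacquetModule_range_fixedPointsMk` (`π_N(a)` preserves `[V^K]`) and the identity `trace_heckeRayEnd_pow_eq`.

## References
* [Casselman1977] W. Casselman, *Characters and Jacquet modules*, Math. Ann. 230 (1977) 101–105, Thm. 5.2.
* [Casselman1995] W. Casselman, *Introduction to the theory of admissible representations of `p`-adic reductive groups* (draft 1 May 1995),
  §4.1 (Prop. 4.1.4, Prop. 4.1.6).
* [BernsteinZelevinsky1976] I. N. Bernstein, A. V. Zelevinsky, Russian Math. Surveys 31:3 (1976), §3.15–3.19.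
* [Rogawski1990] J. D. Rogawski, Ann. of Math. Stud. 123 (1990), §12.7 proof of Lemma 12.7.2 p. 193, Lemma 12.7.3 p. 195.
-/

set_option autoImplicit false

open scoped BigOperators Pointwise
open Literature.NumberTheory.Automorphic

namespace Representation

/-! ## §1 Linear algebra: the trace of a power over a stable splitting with a nilpotent block -/

section LinearAlgebra

variable {k M M' : Type*} [Field k] [AddCommGroup M] [Module k M] [AddCommGroup M'] [Module k M']

/-- Conjugating `(f|p) × (f|q)` along `p × q ≃ M` (for complementary `f`-stable `p`, `q`) gives back `f`. [folklore] -/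
private theorem conj_prodMap_restrict_eq {p q : Submodule k M} (hc : IsCompl p q) (f : Module.End k M)
    (hp : ∀ x ∈ p, f x ∈ p) (hq : ∀ x ∈ q, f x ∈ q) :
    (Submodule.prodEquivOfIsCompl p q hc).conj ((f.restrict hp).prodMap (f.restrict hq)) = f := by
  set e := Submodule.prodEquivOfIsCompl p q hc with he
  have key : ∀ y : p × q, e (((f.restrict hp).prodMap (f.restrict hq)) y) = f (e y) := by
    intro y
    rw [Submodule.coe_prodEquivOfIsCompl', Submodule.coe_prodEquivOfIsCompl', LinearMap.prodMap_apply,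
      LinearMap.coe_restrict_apply, LinearMap.coe_restrict_apply, map_add]
  ext x
  rw [LinearEquiv.conj_apply, LinearMap.comp_apply, LinearMap.comp_apply, LinearEquiv.coe_coe, LinearEquiv.coe_coe, key,
    LinearEquiv.apply_symm_apply]

/-- **Trace over a stable splitting**: `M = p ⊕ q` finite-dimensional, `f` preserving `p` and `q` ⇒ `tr f = tr(f|p) + tr(f|q)`. [folklore] -/
private theorem trace_eq_add_of_isCompl [FiniteDimensional k M] {p q : Submodule k M} (hc : IsCompl p q) (f : Module.End k M)
    (hp : ∀ x ∈ p, f x ∈ p) (hq : ∀ x ∈ q, f x ∈ q) :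
    LinearMap.trace k M f = LinearMap.trace k p (f.restrict hp) + LinearMap.trace k q (f.restrict hq) := by
  conv_lhs => rw [← conj_prodMap_restrict_eq hc f hp hq]
  rw [LinearMap.trace_conj', LinearMap.trace_prodMap']

/-- A NILPOTENT endomorphism of a finite-dimensional vector space has trace `0` (Mathlib: its trace is a nilpotent scalar). [folklore] -/
private theorem trace_eq_zero_of_isNilpotent [FiniteDimensional k M] {f : Module.End k M} (hf : IsNilpotent f) :
    LinearMap.trace k M f = 0 :=
  (LinearMap.isNilpotent_trace_of_isNilpotent hf).eq_zero

/-- **`tr(f^m) = tr((f|q)^m)` for `m ≥ 1`** when `M = p ⊕ q` is finite-dimensional, `f` preserves `p` and `q`, and `f|p` is nilpotent (the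
nilpotent block contributes nothing to the trace of a positive power). [cite: Casselman1995, Prop. 4.1.6] [cite: BernsteinZelevinsky1976, 3.18] -/
theorem trace_pow_eq_trace_restrict_pow_of_isNilpotent [FiniteDimensional k M] {p q : Submodule k M} (hc : IsCompl p q)
    (f : Module.End k M) (hp : ∀ x ∈ p, f x ∈ p) (hq : ∀ x ∈ q, f x ∈ q) (hnil : IsNilpotent (f.restrict hp))
    {m : ℕ} (hm : 1 ≤ m) :
    LinearMap.trace k M (f ^ m) = LinearMap.trace k q ((f.restrict hq) ^ m) := by
  rw [trace_eq_add_of_isCompl hc (f ^ m) (Module.End.pow_apply_mem_of_forall_mem m hp)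
      (Module.End.pow_apply_mem_of_forall_mem m hq),
    ← Module.End.pow_restrict m hp, ← Module.End.pow_restrict m hq,
    trace_eq_zero_of_isNilpotent (hnil.pow_of_pos (n := m) (by omega)), zero_add]

/-! ## §2 Linear algebra: an injective intertwiner onto a stable subspace transports traces -/

/-- **Intertwined restrictions have equal traces.**  `f ∈ End M` preserving `p`, `g ∈ End M′` preserving `W`, and a linear `φ : M → M′` with
`φ(p) = W`, injective on `p`, and `φ (f x) = g (φ x)` on `p`: then `tr(f|p) = tr(g|W)` (`φ|p : p ≃ W` conjugates one to the other).
[cite: Casselman1995, Prop. 4.1.6] -/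
theorem trace_restrict_eq_of_semiconj {p : Submodule k M} {W : Submodule k M'} (f : Module.End k M) (g : Module.End k M')
    (hp : ∀ x ∈ p, f x ∈ p) (hW : ∀ y ∈ W, g y ∈ W) (φ : M →ₗ[k] M') (hφW : p.map φ = W)
    (hinj : ∀ x ∈ p, φ x = 0 → x = 0) (hsemi : ∀ x ∈ p, φ (f x) = g (φ x)) :
    LinearMap.trace k p (f.restrict hp) = LinearMap.trace k W (g.restrict hW) := by
  -- `φ|p : p → W`, bijective
  have hφmem : ∀ x ∈ p, φ x ∈ W := fun x hx => hφW ▸ Submodule.mem_map_of_mem hx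
  set ψ : p →ₗ[k] W := φ.restrict hφmem with hψ
  have hψinj : Function.Injective ψ := by
    intro x y hxy
    have h0 : φ ((x : M) - y) = 0 := by
      rw [map_sub, sub_eq_zero]
      simpa [hψ, LinearMap.restrict_apply, Subtype.ext_iff] using hxy
    exact Subtype.ext (sub_eq_zero.1 (hinj _ (p.sub_mem x.2 y.2) h0))
  have hψsurj : Function.Surjective ψ := by
    rintro ⟨y, hy⟩
    rw [← hφW] at hy
    obtain ⟨x, hx, rfl⟩ := hy
    exact ⟨⟨x, hx⟩, Subtype.ext (by rw [hψ, LinearMap.coe_restrict_apply])⟩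
  set e : p ≃ₗ[k] W := LinearEquiv.ofBijective ψ ⟨hψinj, hψsurj⟩ with he
  -- `e` conjugates `f|p` to `g|W`
  have hconj : e.conj (f.restrict hp) = g.restrict hW := by
    have key : ∀ x : p, e ((f.restrict hp) x) = (g.restrict hW) (e x) := by
      intro x
      apply Subtype.ext
      change (ψ ((f.restrict hp) x) : M') = g (ψ x : M')
      rw [hψ, LinearMap.coe_restrict_apply, LinearMap.coe_restrict_apply, LinearMap.coe_restrict_apply, hsemi _ x.2]
    ext y
    rw [LinearEquiv.conj_apply, LinearMap.comp_apply, LinearMap.comp_apply, LinearEquiv.coe_coe, LinearEquiv.coe_coe, key,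
      LinearEquiv.apply_symm_apply]
  rw [← hconj, LinearMap.trace_conj']

/-- The same for all POWERS: `tr((f|p)^m) = tr((g|W)^m)` (apply §2 to `f^m`, `g^m`, which `φ` still intertwines on `p`). [cite: Casselman1995, Prop. 4.1.6] -/
theorem trace_restrict_pow_eq_of_semiconj {p : Submodule k M} {W : Submodule k M'} (f : Module.End k M) (g : Module.End k M')
    (hp : ∀ x ∈ p, f x ∈ p) (hW : ∀ y ∈ W, g y ∈ W) (φ : M →ₗ[k] M') (hφW : p.map φ = W)
    (hinj : ∀ x ∈ p, φ x = 0 → x = 0) (hsemi : ∀ x ∈ p, φ (f x) = g (φ x)) (m : ℕ) :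
    LinearMap.trace k p ((f.restrict hp) ^ m) = LinearMap.trace k W ((g.restrict hW) ^ m) := by
  have hsemi' : ∀ x ∈ p, φ ((f ^ m) x) = (g ^ m) (φ x) := by
    induction m with
    | zero => intro x _; simp
    | succ n ih =>
      intro x hx
      rw [pow_succ', pow_succ', Module.End.mul_apply, Module.End.mul_apply, hsemi _ (Module.End.pow_apply_mem_of_forall_mem n hp x hx),
        ih x hx]
  rw [Module.End.pow_restrict m hp, Module.End.pow_restrict m hW]
  exact trace_restrict_eq_of_semiconj (f ^ m) (g ^ m) _ _ φ hφW hinj hsemi'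

end LinearAlgebra

/-! ## §3 Casselman's trace identity on `V^K` -/

section Casselman

variable {k G V : Type*} [Field k] [CharZero k] [Group G] [TopologicalSpace G] [IsTopologicalGroup G]
  [AddCommGroup V] [Module k V] {ρ : Representation k G V}

/-- **`π_N(a)` preserves `[V^K]`**: for `v ∈ V^K`, `π_N(a)[v] = [T_a v]` with `T_a v ∈ V^K` (★ `mk_heckeRay`). [cite: Casselman1995, Prop. 4.1.4] -/
theorem mapsTo_jacquetModule_range_fixedPointsMk (t : ParabolicTriple G) {K Nbar : Subgroup G} (hK : IsCompact (K : Set G))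
    (hN : IsClosed (t.N : Set G)) (hρ : ρ.IsSmooth)
    (hfac : (K : Set G) = ((K ⊓ Nbar : Subgroup G) : Set G) * ((K ⊓ t.M : Subgroup G) : Set G) * ((K ⊓ t.N : Subgroup G) : Set G))
    {a : G} (haMem : a ∈ t.M) (haM : ∀ m ∈ K ⊓ t.M, m * a = a * m) (haNbar : ∀ nb ∈ K ⊓ Nbar, a⁻¹ * nb * a ∈ K) :
    ∀ w ∈ LinearMap.range (ρ.fixedPointsMk t K), ρ.jacquetModule t ⟨a, haMem⟩ w ∈ LinearMap.range (ρ.fixedPointsMk t K) := by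
  rintro _ ⟨v, rfl⟩
  refine ⟨ρ.heckeRayEnd hK hρ a v, ?_⟩
  rw [fixedPointsMk_apply, fixedPointsMk_apply, heckeRayEnd_apply_coe, mk_heckeRay t hK hN hρ hfac haMem haM haNbar v.2]

/-- **CASSELMAN'S TRACE IDENTITY (Hecke-ray form): `tr(T_a^m | V^K) = tr(π_N(a)^m | [V^K])` for every `m ≥ 1`** — `ρ` admissible, `K` compact open
Iwahori-factorised, `a ∈ M` dominant with `⋃ₘ a⁻ᵐ (K ∩ N) aᵐ = N`; `[V^K] = range [·] ⊆ V_N` (`= V_N^{K ∩ M}` at Iwahori levels, ★ `range_fixedPointsMk_eq`).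
Proof: Fitting `V^K = ker T_a^{N₀} ⊕ im T_a^{N₀}` (★ `exists_fitting_index`); the nilpotent block has trace-free positive powers (§1); `[·]` maps
`im T_a^{N₀}` injectively (★ `fixedPointsMk_injOn_range_pow`) onto `[V^K]` (★ `map_fixedPointsMk_range_pow_eq`) intertwining `T_a` with `π_N(a)`
(★ `mk_heckeRay`), so §2 applies.  This is the bi-`K`-invariant case of [Casselman1977, Thm. 5.2] «`tr π(f) = tr π_N(f̄^P)` for `f` supported on the
contracting set»: with ★ `real_smul_trace_fixedPointsAlgHom_doubleCosetOperator` the left side is `μ(K)⁻¹ [K aᵐ K : K]⁻¹ · tr π(𝟙_{K aᵐ K})` up to the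
R1 normalisation of `T_a`. [cite: Casselman1977, Thm. 5.2] [cite: Casselman1995, Prop. 4.1.6] [cite: BernsteinZelevinsky1976, 3.17–3.19]
[cite: Rogawski1990, §12.7 p. 193] -/
theorem trace_heckeRayEnd_pow_eq (t : ParabolicTriple G) {K Nbar : Subgroup G} (hK : IsCompact (K : Set G))
    (hKo : IsOpen (K : Set G)) (hN : IsClosed (t.N : Set G)) (hρa : ρ.IsAdmissible)
    (hfac : (K : Set G) = ((K ⊓ Nbar : Subgroup G) : Set G) * ((K ⊓ t.M : Subgroup G) : Set G) * ((K ⊓ t.N : Subgroup G) : Set G))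
    {a : G} (haMem : a ∈ t.M) (haM : ∀ m ∈ K ⊓ t.M, m * a = a * m) (haN : ∀ n ∈ K ⊓ t.N, a * n * a⁻¹ ∈ K)
    (haNbar : ∀ nb ∈ K ⊓ Nbar, a⁻¹ * nb * a ∈ K ⊓ Nbar)
    (hexh : ∀ n ∈ t.N, ∃ m : ℕ, ∀ m', m ≤ m' → a ^ m' * n * (a ^ m')⁻¹ ∈ K) {m : ℕ} (hm : 1 ≤ m) :
    LinearMap.trace k (ρ.fixedPoints K) ((ρ.heckeRayEnd hK hρa.1 a) ^ m) =
      LinearMap.trace k (LinearMap.range (ρ.fixedPointsMk t K))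
        (((ρ.jacquetModule t ⟨a, haMem⟩).restrict
          (mapsTo_jacquetModule_range_fixedPointsMk t hK hN hρa.1 hfac haMem haM
            (fun nb hnb => (Subgroup.mem_inf.1 (haNbar nb hnb)).1))) ^ m) := by
  haveI : FiniteDimensional k (ρ.fixedPoints K) := finite_fixedPoints_of_isAdmissible hρa hK hKo
  obtain ⟨N₀, hc, hker⟩ := exists_fitting_index hρa hK hKo a
  set T := ρ.heckeRayEnd hK hρa.1 a with hT
  -- both Fitting summands are `T`-stable
  have hp : ∀ x ∈ LinearMap.ker (T ^ N₀), T x ∈ LinearMap.ker (T ^ N₀) := by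
    intro x hx
    rw [LinearMap.mem_ker] at hx ⊢
    rw [← Module.End.mul_apply, ← pow_succ, pow_succ', Module.End.mul_apply, hx, map_zero]
  have hq : ∀ x ∈ LinearMap.range (T ^ N₀), T x ∈ LinearMap.range (T ^ N₀) := by
    rintro _ ⟨y, rfl⟩
    exact ⟨T y, by rw [← Module.End.mul_apply, ← pow_succ, pow_succ', Module.End.mul_apply]⟩
  -- `T` is nilpotent on `ker T^{N₀}`
  have hnil : IsNilpotent (T.restrict hp) := by
    refine ⟨N₀, ?_⟩
    rw [Module.End.pow_restrict N₀ hp]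
    exact LinearMap.ext fun x => Subtype.ext ((LinearMap.coe_restrict_apply _ x).trans (LinearMap.mem_ker.1 x.2))
  rw [trace_pow_eq_trace_restrict_pow_of_isNilpotent hc T hp hq hnil hm]
  -- `[·]` conjugates `T | im T^{N₀}` to `π_N(a) | [V^K]`
  refine trace_restrict_pow_eq_of_semiconj T (ρ.jacquetModule t ⟨a, haMem⟩) hq _ (ρ.fixedPointsMk t K)
    (map_fixedPointsMk_range_pow_eq t hK hKo hN hρa hfac haMem haM haN haNbar hexh hc)
    (fun x hx h0 => fixedPointsMk_injOn_range_pow t hK hKo hN hρa hfac haMem haM haN haNbar hexh hc hker hx h0)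
    (fun x _ => ?_) m
  rw [fixedPointsMk_apply, fixedPointsMk_apply, hT, heckeRayEnd_apply_coe,
    mk_heckeRay t hK hN hρa.1 hfac haMem haM (fun nb hnb => (Subgroup.mem_inf.1 (haNbar nb hnb)).1) x.2]

end Casselman

end Representation
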